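/-
Copyright (c) 2026. All rights reserved.
Released under Apache 2.0 license as described in the file LICENSE.
-/
import Literature.Probability.FitznerVanDerHofstad2017.SrwTrigMajorantEncl
import Literature.Probability.FitznerVanDerHofstad2017.SrwTwistDhatShift
import HarnessLib

/-!
# The `KM₂` row (`l = 0`) from EVEN pure-class enclosures

Support module (d-generic, number-free, definition-free): the consumer row of the `KM₂_{n,0}` cell over the
EVEN cosine-product classes only.  `SrwTwistDhatShift` (`srwTwist_abs_Dhat_pow_zero_mul_Mhat_sq_encl_even`)
encloses the row weight moment `Tw^{|D̂|⁰M̂²}_n(x;β)` by the nine even class moments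
`[2]ₙ, [1,1]ₙ, [0]ₙ, [0]ₙ₊₁, [2]ₙ₊₁, [0]ₙ₊₂, [2]ₙ₊₂, [4]ₙ₊₂, [2,2]ₙ₊₂` (the odd classes of the order-`n+1`
term being eliminated by `D̂ Ĉ = Ĉ − 1`); composing with the trigonometric-majorant row over enclosed inputs
`srwKM2_le_gset_encl_cast` (`SrwTrigMajorantEncl`, literal coefficients `MajCert.gset`, abscissae `gsetB r`)
gives ONE theorem `srwKM2_zero_le_gset_evenClassEncl_cast` whose hypotheses are rational enclosures of those
nine class moments at `β = 0` and at the six abscissae, plus a rational bound `Shi` on the `Sq`-moment of the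
weight, concluding `KM₂_{n,0}(x) ≤ ((rational expression : ℚ) : ℝ)` — every input certifiable by the
parity-`0` product kernel.  Companion of the class rows of `SrwTrigMajorantClassRows`.

All statements are exact bookkeeping for general `d`; nothing here is numerical and nothing is a
certificate.  No dimension-specific declaration is introduced.

References: [FvdH17] R. Fitzner, R. van der Hofstad, *Mean-field behavior for nearest-neighbor
percolation in `d > 10`*, Electron. J. Probab. 22 (2017) no. 43 and the NoBLE companion PTRF 169 (2017)
1041–1119, (3.36)–(3.38) p. 1071, §5.1.2 (5.11)–(5.16) pp. 1091–1092, §5.2 (5.9), (5.14) p. 1092.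
-/

noncomputable section

open MeasureTheory Real Finset
open scoped BigOperators

namespace Literature.Probability.FitznerVanDerHofstad2017

open TrigEncl
open Literature.Barriers.CriticalPhenomena
open Literature.Barriers.CriticalPhenomena.Slade2006Prop53 (P)

variable {d : ℕ}

/-- **`KM₂_{n,0}(x)` from EVEN pure-class enclosures** (`i ≠ i'`, `d ≥ 2(n+2)+1`; classes `[2] = cos² k_i`,
`[1,1] = cos k_i cos k_{i'}`, `[0] = 1`, `[4] = cos⁴ k_i`, `[2,2] = cos² k_i cos² k_{i'}` at the Schwinger orders
`n` (`[2]`, `[1,1]`, `[0]`: enclosures `[T·, T·']` at `β = 0`, `[l· r, h· r]` at `gsetB r`), `n+1` (`[0]`, `[2]`: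
`[V·, V·']`, `[p· r, q· r]`) and `n+2` (`[0]`, `[2]`, `[4]`, `[2,2]`: `[W·, W·']`, `[u· r, v· r]`), and
`Sq^{|D̂|⁰M̂²}_n(x) ≤ Shi`): the `KM₂` row of `srwKM2_le_gset_encl_cast` with the even-class lower / upper
combinations of `srwTwist_abs_Dhat_pow_zero_mul_Mhat_sq_encl_even`, as ONE closed rational expression.
[cite: FitznerVanDerHofstad2016NoBLE, (3.36)–(3.38) p. 1071, §5.1.2 (5.11)–(5.16) pp. 1091–1092, §5.2 (5.9), (5.14) p. 1092] -/
theorem srwKM2_zero_le_gset_evenClassEncl_cast {n : ℕ} (hd : 2 * (n + 2) + 1 ≤ d) {i i' : Fin d}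
    (hii' : i ≠ i') (x : Fin d → ℤ)
    {T₂ T₂' T₁₁ T₁₁' T₀ T₀' V₀ V₀' V₂ V₂' W₀ W₀' W₂ W₂' W₄ W₄' W₂₂ W₂₂' Shi : ℚ}
    {l₂ h₂ l₁₁ h₁₁ l₀ h₀ p₀ q₀ p₂ q₂ u₀ v₀ u₂ v₂ u₄ v₄ u₂₂ v₂₂ : Fin 6 → ℚ}
    (hT2 : (T₂ : ℝ) ≤ srwTwist d n (fun k => Real.cos (k i) ^ 2) x 0
      ∧ srwTwist d n (fun k => Real.cos (k i) ^ 2) x 0 ≤ (T₂' : ℝ))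
    (hT11 : (T₁₁ : ℝ) ≤ srwTwist d n (fun k => Real.cos (k i) * Real.cos (k i')) x 0
      ∧ srwTwist d n (fun k => Real.cos (k i) * Real.cos (k i')) x 0 ≤ (T₁₁' : ℝ))
    (hT0 : (T₀ : ℝ) ≤ srwTwist d n (fun _ => (1 : ℝ)) x 0 ∧ srwTwist d n (fun _ => (1 : ℝ)) x 0 ≤ (T₀' : ℝ))
    (hV0 : (V₀ : ℝ) ≤ srwTwist d (n + 1) (fun _ => (1 : ℝ)) x 0
      ∧ srwTwist d (n + 1) (fun _ => (1 : ℝ)) x 0 ≤ (V₀' : ℝ))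
    (hV2 : (V₂ : ℝ) ≤ srwTwist d (n + 1) (fun k => Real.cos (k i) ^ 2) x 0
      ∧ srwTwist d (n + 1) (fun k => Real.cos (k i) ^ 2) x 0 ≤ (V₂' : ℝ))
    (hW0 : (W₀ : ℝ) ≤ srwTwist d (n + 2) (fun _ => (1 : ℝ)) x 0
      ∧ srwTwist d (n + 2) (fun _ => (1 : ℝ)) x 0 ≤ (W₀' : ℝ))
    (hW2 : (W₂ : ℝ) ≤ srwTwist d (n + 2) (fun k => Real.cos (k i) ^ 2) x 0
      ∧ srwTwist d (n + 2) (fun k => Real.cos (k i) ^ 2) x 0 ≤ (W₂' : ℝ))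
    (hW4 : (W₄ : ℝ) ≤ srwTwist d (n + 2) (fun k => Real.cos (k i) ^ 4) x 0
      ∧ srwTwist d (n + 2) (fun k => Real.cos (k i) ^ 4) x 0 ≤ (W₄' : ℝ))
    (hW22 : (W₂₂ : ℝ) ≤ srwTwist d (n + 2) (fun k => Real.cos (k i) ^ 2 * Real.cos (k i') ^ 2) x 0
      ∧ srwTwist d (n + 2) (fun k => Real.cos (k i) ^ 2 * Real.cos (k i') ^ 2) x 0 ≤ (W₂₂' : ℝ))
    (hS : srwSqMom d n (fun k => |Dhat d k| ^ 0 * Mhat d k ^ 2) x ≤ (Shi : ℝ))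
    (h2 : ∀ r, (l₂ r : ℝ) ≤ srwTwist d n (fun k => Real.cos (k i) ^ 2) x (gsetB r)
      ∧ srwTwist d n (fun k => Real.cos (k i) ^ 2) x (gsetB r) ≤ (h₂ r : ℝ))
    (h11 : ∀ r, (l₁₁ r : ℝ) ≤ srwTwist d n (fun k => Real.cos (k i) * Real.cos (k i')) x (gsetB r)
      ∧ srwTwist d n (fun k => Real.cos (k i) * Real.cos (k i')) x (gsetB r) ≤ (h₁₁ r : ℝ))
    (h0 : ∀ r, (l₀ r : ℝ) ≤ srwTwist d n (fun _ => (1 : ℝ)) x (gsetB r)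
      ∧ srwTwist d n (fun _ => (1 : ℝ)) x (gsetB r) ≤ (h₀ r : ℝ))
    (g0 : ∀ r, (p₀ r : ℝ) ≤ srwTwist d (n + 1) (fun _ => (1 : ℝ)) x (gsetB r)
      ∧ srwTwist d (n + 1) (fun _ => (1 : ℝ)) x (gsetB r) ≤ (q₀ r : ℝ))
    (g2 : ∀ r, (p₂ r : ℝ) ≤ srwTwist d (n + 1) (fun k => Real.cos (k i) ^ 2) x (gsetB r)
      ∧ srwTwist d (n + 1) (fun k => Real.cos (k i) ^ 2) x (gsetB r) ≤ (q₂ r : ℝ))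
    (f0 : ∀ r, (u₀ r : ℝ) ≤ srwTwist d (n + 2) (fun _ => (1 : ℝ)) x (gsetB r)
      ∧ srwTwist d (n + 2) (fun _ => (1 : ℝ)) x (gsetB r) ≤ (v₀ r : ℝ))
    (f2 : ∀ r, (u₂ r : ℝ) ≤ srwTwist d (n + 2) (fun k => Real.cos (k i) ^ 2) x (gsetB r)
      ∧ srwTwist d (n + 2) (fun k => Real.cos (k i) ^ 2) x (gsetB r) ≤ (v₂ r : ℝ))
    (f4 : ∀ r, (u₄ r : ℝ) ≤ srwTwist d (n + 2) (fun k => Real.cos (k i) ^ 4) x (gsetB r)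
      ∧ srwTwist d (n + 2) (fun k => Real.cos (k i) ^ 4) x (gsetB r) ≤ (v₄ r : ℝ))
    (f22 : ∀ r, (u₂₂ r : ℝ) ≤ srwTwist d (n + 2) (fun k => Real.cos (k i) ^ 2 * Real.cos (k i') ^ 2) x (gsetB r)
      ∧ srwTwist d (n + 2) (fun k => Real.cos (k i) ^ 2 * Real.cos (k i') ^ 2) x (gsetB r) ≤ (v₂₂ r : ℝ)) :
    srwKM2 d n 0 x ≤ ((max
          (MajCert.gset.B * ((1 / d * T₂ + ((d : ℚ) - 1) / d * T₁₁)
            - 4 * (1 / d * (((V₀' - V₂) - (T₀ - T₂'))))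
            + 4 * ((1 / (d : ℚ)) ^ 3 * (((W₀ - W₂') - (W₂' - W₄)) + ((d : ℚ) - 1) * ((W₀ - W₂') - (W₂' - W₂₂))))))
          (MajCert.gset.B * ((1 / d * T₂' + ((d : ℚ) - 1) / d * T₁₁')
            - 4 * (1 / d * (((V₀ - V₂') - (T₀' - T₂))))
            + 4 * ((1 / (d : ℚ)) ^ 3 * (((W₀' - W₂) - (W₂ - W₄')) + ((d : ℚ) - 1) * ((W₀' - W₂) - (W₂ - W₂₂'))))))
        + MajCert.gset.c * Shi
        + ∑ r : Fin 6, max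
          (MajCert.gset.a r * ((1 / d * l₂ r + ((d : ℚ) - 1) / d * l₁₁ r)
            - 4 * (1 / d * (((q₀ r - p₂ r) - (l₀ r - h₂ r))))
            + 4 * ((1 / (d : ℚ)) ^ 3 * (((u₀ r - v₂ r) - (v₂ r - u₄ r))
              + ((d : ℚ) - 1) * ((u₀ r - v₂ r) - (v₂ r - u₂₂ r))))))
          (MajCert.gset.a r * ((1 / d * h₂ r + ((d : ℚ) - 1) / d * h₁₁ r)
            - 4 * (1 / d * (((p₀ r - q₂ r) - (h₀ r - l₂ r))))
            + 4 * ((1 / (d : ℚ)) ^ 3 * (((v₀ r - u₂ r) - (u₂ r - v₄ r))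
              + ((d : ℚ) - 1) * ((v₀ r - u₂ r) - (u₂ r - v₂₂ r)))))) : ℚ) : ℝ) := by
  have hd0 : 2 * n + 1 ≤ d := by omega
  have hT : ((((1 / d * T₂ + ((d : ℚ) - 1) / d * T₁₁)
            - 4 * (1 / d * (((V₀' - V₂) - (T₀ - T₂'))))
            + 4 * ((1 / (d : ℚ)) ^ 3 * (((W₀ - W₂') - (W₂' - W₄))
              + ((d : ℚ) - 1) * ((W₀ - W₂') - (W₂' - W₂₂))))) : ℚ) : ℝ)
        ≤ srwTwist d n (fun k => |Dhat d k| ^ 0 * Mhat d k ^ 2) x 0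
      ∧ srwTwist d n (fun k => |Dhat d k| ^ 0 * Mhat d k ^ 2) x 0
        ≤ ((((1 / d * T₂' + ((d : ℚ) - 1) / d * T₁₁')
            - 4 * (1 / d * (((V₀ - V₂') - (T₀' - T₂))))
            + 4 * ((1 / (d : ℚ)) ^ 3 * (((W₀' - W₂) - (W₂ - W₄'))
              + ((d : ℚ) - 1) * ((W₀' - W₂) - (W₂ - W₂₂'))))) : ℚ) : ℝ) := by
    push_cast
    exact srwTwist_abs_Dhat_pow_zero_mul_Mhat_sq_encl_even hd hii' x 0 hT2 hT11 hT0 hV0 hV2 hW0 hW2 hW4 hW22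
  have hr : ∀ r : Fin 6,
      ((((1 / d * l₂ r + ((d : ℚ) - 1) / d * l₁₁ r)
            - 4 * (1 / d * (((q₀ r - p₂ r) - (l₀ r - h₂ r))))
            + 4 * ((1 / (d : ℚ)) ^ 3 * (((u₀ r - v₂ r) - (v₂ r - u₄ r))
              + ((d : ℚ) - 1) * ((u₀ r - v₂ r) - (v₂ r - u₂₂ r))))) : ℚ) : ℝ)
        ≤ srwTwist d n (fun k => |Dhat d k| ^ 0 * Mhat d k ^ 2) x (gsetB r)
      ∧ srwTwist d n (fun k => |Dhat d k| ^ 0 * Mhat d k ^ 2) x (gsetB r)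
        ≤ ((((1 / d * h₂ r + ((d : ℚ) - 1) / d * h₁₁ r)
            - 4 * (1 / d * (((p₀ r - q₂ r) - (h₀ r - l₂ r))))
            + 4 * ((1 / (d : ℚ)) ^ 3 * (((v₀ r - u₂ r) - (u₂ r - v₄ r))
              + ((d : ℚ) - 1) * ((v₀ r - u₂ r) - (u₂ r - v₂₂ r))))) : ℚ) : ℝ) := fun r => by
    push_cast
    exact srwTwist_abs_Dhat_pow_zero_mul_Mhat_sq_encl_even hd hii' x (gsetB r) (h2 r) (h11 r) (h0 r)
      (g0 r) (g2 r) (f0 r) (f2 r) (f4 r) (f22 r)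
  exact srwKM2_le_gset_encl_cast hd0 0 x hT hS hr

end Literature.Probability.FitznerVanDerHofstad2017

end
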